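import Mathlib
import Summits.CriticalPhenomena.CardyFormulaZ2.Theorems.CardySelfRefinementTrivialSectorRateStubBoundaryRelevanceTwoArmWindow
import Summits.CriticalPhenomena.CardyFormulaZ2.Theorems.CardySelfRefinementTrivialSectorRateStubBoundaryRelevanceClusterTail
import HarnessLib

/-!
# Helper (W1) of stub `stub_boundaryRelevance`, line `far-field-is-a-quarter-turn`
(crux `TrivialSectorRate`, stmt-CriticalPhenomena-10266): the docked half-plane TWO-ARM WINDOW BOUND
for the self-refinement model `M_k` along an RSW path, unconditionally

Lawler–Schramm–Werner's Lemma A.1 in window form (exponent exactly `1`) for `M_k(γ s)`, uniformly in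
the path parameter `s` of an admissible path (`PathOK k γ`, `k = 2, 3`) and at EVERY vertical
offset `t` of the boundary line (the model is only `kℤ²`-periodic, so the event is read on the
configuration translated by `(0, t)`):

* `twoArm_window_along` — there are `C > 0`, `K ≥ 1` with
  `M_k(γ s){ω | ω + (0,t) ∈ Z2HalfPlane.twoArm j m R} ≤ C m / n` for `1 ≤ m ≤ n`, `K n ≤ R`.

Assembly of the two landed halves: the conditional window bound `twoArm_window_along_of_tail`
(file `…StubBoundaryRelevanceTwoArmWindow.lean`: Werner's cluster counting through the tree's
deterministic `Z2HalfPlane.card_filter_twoArmLE_le`, `kℤ`-periodicity, RSW at a fixed ratio along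
the path; its generic core `real_twoArm_le_of_periodic` only needs the tail of `Z` for the
HALF-PLANE restriction) and the vertex-induced tail bound
`M_real_setOf_le_numCrossingClusters_shift_induce_le_pow` (file `…ClusterTail.lean`: second
read-out certificates + iterated Reimer on the coin product), applied with `V₀ = {v | 0 ≤ v 1}`,
whose induced edge set is `Z2HalfPlane.hpEdges` by definition.  (The tail bound for an ARBITRARY
edge restriction is false for `k = 3` — two routes through the outer sub-edges of one bundle —
which is why the assembly goes through the vertex-induced form.)

References: G. F. Lawler, O. Schramm, W. Werner, Electron. J. Probab. 7 (2002), Appendix A,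
Lemma A.1; W. Werner, *Lectures on two-dimensional critical percolation* (PCMI 2007), Lecture 2.
-/

noncomputable section

namespace Summit.CriticalPhenomena.CardyFormulaZ2.Theorems.CardySelfRefinement.FarField

open Set MeasureTheory
open Literature.Probability.LatticeModels Literature.Probability.Percolation
open Literature.Probability.Percolation.QuadCrossing
open Summit.CriticalPhenomena.CardyFormulaZ2.Theses.CardySelfRefinement

/-- **The docked half-plane two-arm window bound for `M_k` along an RSW path** (unconditional):
for `PathOK k γ`, `k = 2, 3`, there are `C > 0` and `K ≥ 1` such that for every path parameter `s`,
every vertical offset `t`, every window `[j, j+m)` and all `1 ≤ m ≤ n`, `K n ≤ R`, the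
`M_k(γ s)`-probability that the configuration translated by `(0,t)` has an open arm docked in the
window and a closed dual arm from the moat under it, both to sup-distance `R`, is at most `C m / n`. -/
theorem twoArm_window_along {k : ℕ} (hk : k = 2 ∨ k = 3) {γ : unitInterval → ℝ × ℝ}
    (hγ : PathOK k γ) :
    ∃ C : ℝ, 0 < C ∧ ∃ K : ℕ, 1 ≤ K ∧ ∀ (s : unitInterval) (t j : ℤ) (m n R : ℕ),
      1 ≤ m → m ≤ n → K * n ≤ R →
        (M k (γ s).1 (γ s).2).real
          (BondConfig.relabel (sym2Equiv (Site.shift (![0, t] : Site 2))) ⁻¹' Z2HalfPlane.twoArm j m R) ≤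
          C * m / n := by
  have hk0 : 0 < k := by rcases hk with rfl | rfl <;> norm_num
  have hk3 : k ≤ 3 := by rcases hk with rfl | rfl <;> norm_num
  obtain ⟨K₀, N₀, hK₀, hN₀, hA⟩ := exists_ratio_real_preimage_boxCrossingEvent_le_half_along hk hγ
  have hN₀' : (0 : ℝ) < N₀ := by exact_mod_cast hN₀
  refine ⟨12 * N₀, by positivity, K₀ + 2, by omega, fun s t j m n R hm hmn hR => ?_⟩
  set μ := M k (γ s).1 (γ s).2 with hμ
  haveI : IsProbabilityMeasure μ := isProbabilityMeasure_M k _ _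
  set T := BondConfig.relabel (sym2Equiv (Site.shift (![0, t] : Site 2))) with hT
  haveI : IsProbabilityMeasure (μ.map T) := Measure.isProbabilityMeasure_map T.measurable.aemeasurable
  -- the translated law is carried by lattice configurations
  have hae : ∀ᵐ ω ∂(μ.map T), ω ⊆ (zdGraph 2).edgeSet := by
    refine T.measurableEmbedding.ae_map_iff.2 ?_
    filter_upwards [selfRefinementMeasure_ae_subset_edgeSet k (γ s).1 (γ s).2] with ω hω
    exact relabel_shift_subset_edgeSet _ hω
  -- it is invariant under the horizontal translations of `kℤ` (they commute with `T`)
  have hinv : ∀ (a : ℤ) (A : Set (BondConfig (Site 2))),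
      (μ.map T).real
          (BondConfig.relabel (sym2Equiv (Site.shift (Z2HalfPlane.hvec ((k : ℤ) * a)))) ⁻¹' A) =
        (μ.map T).real A := by
    intro a A
    rw [hT, real_map_relabel_shift, real_map_relabel_shift,
      ← M_real_preimage_relabel_shift_smul hk0.ne' (γ s).1 (γ s).2 (![a, 0] : Site 2)
        (BondConfig.relabel (sym2Equiv (Site.shift (![0, t] : Site 2))) ⁻¹' A)]
    congr 1
    ext ω
    simp only [mem_preimage]
    rw [relabel_shift_relabel_shift, relabel_shift_relabel_shift, hvec_mul_eq_smul, add_comm]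
  -- the half-plane edges are the edges induced on the sites of nonnegative height
  have hhp : Z2HalfPlane.hpEdges = {e : Sym2 (Site 2) | ∀ z ∈ e, z ∈ {v : Site 2 | (0 : ℤ) ≤ v 1}} := rfl
  -- the tail of `Z` for the translated law, from the vertex-induced tail bound and RSW at ratio `K₀`
  have htail' : ∀ N : ℕ, N₀ ≤ N → ∀ i : ℕ,
      (μ.map T).real {ω | i ≤ numCrossingClusters (ω ∩ Z2HalfPlane.hpEdges) N (K₀ * N)} ≤
        (1 / 2) ^ i := by
    intro N hN i
    rw [hT, real_map_relabel_shift, preimage_setOf_eq, hhp]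
    refine (M_real_setOf_le_numCrossingClusters_shift_induce_le_pow hk0 hk3 (γ s) _
      {v : Site 2 | (0 : ℤ) ≤ v 1} N (K₀ * N) i).trans (pow_le_pow_left₀ measureReal_nonneg ?_ i)
    refine (measureReal_mono (fun ω hω => ?_) (measure_ne_top _ _)).trans (hA s (![0, t]) N hN)
    exact isUpperSet_boxCrossingEvent N (K₀ * N) inter_subset_left hω
  have key := real_twoArm_le_of_periodic hk0 hk3 (μ.map T) hae hinv (by omega) hN₀ htail' j hm hmn hR
  rwa [hT, real_map_relabel_shift] at key

end Summit.CriticalPhenomena.CardyFormulaZ2.Theorems.CardySelfRefinement.FarField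

end
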